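import Literature.AlgebraicGeometry.HodgeTheory.BettiKunnethPieceCorrespondenceRepresentationRank
import Literature.AlgebraicGeometry.HodgeTheory.BettiHodgeGroupMinusIdentityParity
import Literature.AlgebraicGeometry.HodgeTheory.ComplexGysinHodgeType
import Literature.AlgebraicGeometry.HodgeTheory.HodgeTypePullback
import Literature.AlgebraicGeometry.HodgeTheory.ComplexOrientationCycleClassFacts
import Literature.AlgebraicGeometry.HodgeTheory.MaxRationalSubHodgeStructureFunctoriality
import HarnessLib

/-!
# The action `γ_* u = pr_{Y*}(pr_Z^* u ∪ γ)` of a class `γ ∈ H^{2c}(Y × Z;ℂ)` of Hodge type `(s, t)` maps `H^{p,q}(Z)` to `H^{p+s−n, q+t−n}(Y)` (`n = dim Z`), kills `H^{p,q}(Z)` when `p + s < n` or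
# `q + t < n`, preserves rational classes, and — for `γ` a Hodge class — sends Hodge classes to Hodge classes: «a Hodge class of `Y × Z` induces a morphism of Hodge structures» (Lemma 11.41)
# (Voisin I §7.3.2 (7.11), §11.1.2 Prop. 11.20, §11.3.3 Lemma 11.41, p. 286; Voisin II proof of Prop. 10.26; Fulton App. B (5)–(6))

Family `hodge`, lane `lit-hodgefound` (Track 2 foundations library; Layers A1/A4), layer `Literature/AlgebraicGeometry/HodgeTheory`.  THEOREMS ONLY (no definition, no named fact, no instance;
D-0026 net debt `0`).  The tree proves that pull-backs preserve Hodge types (`preservesHodgeType_of_nonempty_hodgeModel`), that the cup product adds them (`BettiUniverse.cupPreservesHodgeType`), that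
the Gysin morphism of `f : W → X` shifts them by `−(dim W − dim X)` (`isOfHodgeType_complexGysin_of_cupPreservesHodgeType`) and vanishes on types below the relative dimension
(`complexGysin_eq_zero_of_isOfHodgeType_of_lt`), and that all three preserve rational classes; it records the Hodge-type behaviour of correspondence actions for CYCLE classes of an abstract Gysin
formalism (`GysinFormalism.IsHodgeCompatible.isOfHodgeType_corrActGen`).  This file assembles the same for the tree's concrete action `corrAction μ hY hZ hab γ` (`γ_* u = pr_{Y*}(pr_Z^* u ∪ γ)`,
`a + 2c = i + 2 dim Z`) of an ARBITRARY class `γ ∈ H^{2c}(Y × Z;ℂ)` of Hodge type `(s, t)`, as used throughout the seat's g30 files: **`γ_*` maps type `(p, q)` to type `(p + s − n, q + t − n)`**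
(§1), **vanishes on `H^{p,q}(Z)` if `p + s < n` or `q + t < n`** (§1, complex orientations), **preserves rational classes** (§2, complex orientations or any orientation family with rational
fundamental classes), hence **a Hodge class `γ` (rational of type `(c, c)`) maps `Hdgᵖ(H^{2p}Z)` into `Hdg^{p+c−n}(H^{2(p+c−n)}Y)`** (§3) — the direction «Hodge class ⇒ morphism of Hodge structures of
bidegree `(c − n, c − n)`» of Lemma 11.41 on the carriers (the converse, «morphism ⇒ Hodge class», is the tree's `HodgeClassOfMorphism*` / `exists_hodgeClass_corrAction_eq_smul_of_shift`).

WHAT IS PROVED.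
* §1 **`isOfHodgeType_corrAction`** (type `(p,q)` ↦ `(p', q')`, `p' + n = p + s`, `q' + n = q + t`), **`isOfHodgeType_corrAction_of_type_self`** (`γ` of type `(c,c)`: `p' + n = p + c`, `q' + n = q + c`),
  **`corrAction_eq_zero_of_isOfHodgeType_of_lt`** (`p + s < n ∨ q + t < n` ⇒ `γ_* u = 0`, complex orientations).
* §2 **`isRationalClass_corrAction_of_hasRationalFundamentalClasses`**, **`isRationalClass_corrAction_complexOrientationFamily`** (`γ`, `u` rational ⇒ `γ_* u` rational).
* §3 **`BettiUniverse.exists_mem_hodgeClasses_ofRatClass_eq_corrAction`** (`γ ∈ Hdgᶜ(H^{2c}(Y × Z))`, `v ∈ Hdgᵖ(H^{2p}Z)`, `p' + n = p + c` ⇒ `(γ ⊗ 1)_*(v ⊗ 1) = w ⊗ 1` with `w ∈ Hdg^{p'}(H^{2p'}Y)`),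
  **`BettiUniverse.corrAction_ofRatClass_eq_zero_of_mem_hodgeClasses_of_lt`** (`p + c < n` ⇒ `(γ ⊗ 1)_*(v ⊗ 1) = 0`).

THE PRINTS.  C. Voisin (2002) [VoisinHodgeI2002] §7.3.2 (7.11) and Lemma 7.28; §11.1.2 Prop. 11.20; §11.3.3 Lemma 11.41 and p. 286.  C. Voisin (2003) [VoisinHodgeII2003] §10.3.1 proof of Prop. 10.26.  W. Fulton (1997)
[FultonYoungTableaux1997] Appendix B §B.1 (5)–(6).

THE OBJECTS (all the tree's).  `corrAction μ hY hZ hab`, `corrAction_apply`, `complexGysin`, `cupProduct`, `complexBetti.map (snd Y Z) a`, `IsOfHodgeType`, `IsRationalClass`, `BettiUniverse.hodge hHD hX k`, `hodgeClasses`, `ofRatClass`,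
`OrientationFamily.HasRationalFundamentalClasses`, `complexOrientationFamily`; `preservesHodgeType_of_nonempty_hodgeModel`, `BettiUniverse.cupPreservesHodgeType`, `isOfHodgeType_complexGysin_of_cupPreservesHodgeType`,
`complexGysin_eq_zero_of_isOfHodgeType_of_lt`, `isRationalClass_complexGysin_of_hasRationalFundamentalClasses`, `isRationalClass_complexGysin_complexOrientationFamily`, `BettiUniverse.mem_hodgeClasses_hodge_iff_isOfHodgeType`.

DEVIATIONS / SCOPE.  Carriers only: no `HodgeStructure.Hom` is constructed (that packaging is the tree's `HodgeModel.exists_hom_of_typeShift`).  No definitions.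

## References
* [VoisinHodgeI2002] C. Voisin, *Hodge Theory and Complex Algebraic Geometry I* (2002) — §7.3.2 (7.11), Lemma 7.28; §11.1.2 Prop. 11.20; §11.3.3 Lemma 11.41, p. 286.
* [VoisinHodgeII2003] C. Voisin, *Hodge Theory and Complex Algebraic Geometry II* (2003) — §10.3.1 proof of Prop. 10.26.
* [FultonYoungTableaux1997] W. Fulton, *Young Tableaux* (1997) — Appendix B §B.1 (5)–(6).

## Provenance
Lane `lit-hodgefound` (Hodge path, Track 2), prover seat `lit-hodgefound-p29` (generation 30), self-proposed row g30-#12 (Hodge type of correspondence actions; companion of g30-#2/#9/#11).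
-/

noncomputable section

open scoped TensorProduct
open CategoryTheory MonoidalCategory CartesianMonoidalCategory Module Finset
open Literature.AlgebraicTopology.SingularHomology
open Literature.Geometry.Kaehler

namespace Literature.AlgebraicGeometry.HodgeTheory

open Literature.AlgebraicGeometry.Motives
open Literature.AlgebraicGeometry.Motives.HodgeStructure

variable {m n : ℕ} {Y Z : SchemeOver ℂ}

/-! ### §1 The Hodge type of `γ_* u` -/

section HodgeType

variable (μ : OrientationFamily)

/-- **A class `γ ∈ H^{2c}(Y × Z;ℂ)` of Hodge type `(s, t)` acts from type `(p, q)` to type `(p + s − n, q + t − n)`** (`n = dim Z`; `γ_* u = pr_{Y*}(pr_Z^* u ∪ γ)`: `pr_Z^*` preserves types, `∪ γ` adds `(s, t)`,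
`pr_{Y*}` subtracts `(n, n)`), for every orientation family `μ`. [cite: VoisinHodgeI2002, §7.3.2 (7.11) and Lemma 7.28, §11.1.2 Prop. 11.20, §11.3.3 Lemma 11.41] [cite: VoisinHodgeII2003, §10.3.1 proof of Prop. 10.26] -/
theorem isOfHodgeType_corrAction (hHD : exists_isReal_hodgeModel) (hY : IsSmoothProjective m Y) (hZ : IsSmoothProjective n Z) {c i a : ℕ} (hab : a + 2 * c = i + 2 * n) {s t : ℕ}
    {γ : complexBetti (Y ⊗ Z) (2 * c)} (hγ : IsOfHodgeType (m + n) (Y ⊗ Z) (2 * c) s t γ) {p q p' q' : ℕ} (hp : p' + n = p + s) (hq : q' + n = q + t) {u : complexBetti Z a}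
    (hu : IsOfHodgeType n Z a p q u) : IsOfHodgeType m Y i p' q' (corrAction μ hY hZ hab γ u) := by
  have hI := hodgePQ_independent_of_hodgeModel_holds
  have hYZ := hY.tensor_holds hZ
  rw [corrAction_apply]
  have h1 : IsOfHodgeType (m + n) (Y ⊗ Z) a p q (complexBetti.map (snd Y Z) a u) :=
    preservesHodgeType_of_nonempty_hodgeModel hI (BettiUniverse.nonempty_hodgeModel_of hHD) hYZ hZ (snd Y Z) hu
  have h2 : IsOfHodgeType (m + n) (Y ⊗ Z) (a + 2 * c) (p + s) (q + t) (cupProduct rfl (complexBetti.map (snd Y Z) a u) γ) :=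
    BettiUniverse.cupPreservesHodgeType hHD hI hYZ rfl h1 hγ
  exact isOfHodgeType_complexGysin_of_cupPreservesHodgeType hI μ hYZ hY (BettiUniverse.realHodgeModel hHD hYZ) (BettiUniverse.realHodgeModel hHD hY)
    (BettiUniverse.cupPreservesHodgeType hHD hI hYZ) (BettiUniverse.cupPreservesHodgeType hHD hI hY) (fst Y Z) (corrAction_degree m hab) (by omega) (by omega) h2

/-- **A class of type `(c, c)` acts with bidegree `(c − n, c − n)`**: type `(p, q)` ↦ type `(p', q')` with `p' + n = p + c`, `q' + n = q + c`. [cite: VoisinHodgeI2002, §11.3.3 Lemma 11.41 and p. 286] -/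
theorem isOfHodgeType_corrAction_of_type_self (hHD : exists_isReal_hodgeModel) (hY : IsSmoothProjective m Y) (hZ : IsSmoothProjective n Z) {c i a : ℕ} (hab : a + 2 * c = i + 2 * n)
    {γ : complexBetti (Y ⊗ Z) (2 * c)} (hγ : IsOfHodgeType (m + n) (Y ⊗ Z) (2 * c) c c γ) {p q p' q' : ℕ} (hp : p' + n = p + c) (hq : q' + n = q + c) {u : complexBetti Z a}
    (hu : IsOfHodgeType n Z a p q u) : IsOfHodgeType m Y i p' q' (corrAction μ hY hZ hab γ u) :=
  isOfHodgeType_corrAction μ hHD hY hZ hab hγ hp hq hu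

end HodgeType

/-- **A class of type `(s, t)` kills `H^{p,q}(Z)` when `p + s < dim Z` or `q + t < dim Z`** (the Gysin morphism `pr_{Y*}` of relative dimension `n` vanishes on types `(P, Q)` with `P < n` or `Q < n`;
complex orientations). [cite: VoisinHodgeI2002, §7.3.2 (7.11) and Lemma 7.28] -/
theorem corrAction_eq_zero_of_isOfHodgeType_of_lt (hHD : exists_isReal_hodgeModel) (hY : IsSmoothProjective m Y) (hZ : IsSmoothProjective n Z) {c i a : ℕ} (hab : a + 2 * c = i + 2 * n) {s t : ℕ}
    {γ : complexBetti (Y ⊗ Z) (2 * c)} (hγ : IsOfHodgeType (m + n) (Y ⊗ Z) (2 * c) s t γ) {p q : ℕ} (hlt : p + s < n ∨ q + t < n) {u : complexBetti Z a} (hu : IsOfHodgeType n Z a p q u) :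
    corrAction complexOrientationFamily hY hZ hab γ u = 0 := by
  have hI := hodgePQ_independent_of_hodgeModel_holds
  have hYZ := hY.tensor_holds hZ
  rw [corrAction_apply]
  have h1 : IsOfHodgeType (m + n) (Y ⊗ Z) a p q (complexBetti.map (snd Y Z) a u) :=
    preservesHodgeType_of_nonempty_hodgeModel hI (BettiUniverse.nonempty_hodgeModel_of hHD) hYZ hZ (snd Y Z) hu
  have h2 : IsOfHodgeType (m + n) (Y ⊗ Z) (a + 2 * c) (p + s) (q + t) (cupProduct rfl (complexBetti.map (snd Y Z) a u) γ) :=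
    BettiUniverse.cupPreservesHodgeType hHD hI hYZ rfl h1 hγ
  exact complexGysin_eq_zero_of_isOfHodgeType_of_lt hYZ hY (fst Y Z) (r := n) (by omega) (corrAction_degree m hab) hlt h2

/-! ### §2 Rationality of `γ_* u` -/

/-- **`γ_* u` is rational for `γ`, `u` rational**, for an orientation family with rational fundamental classes (`pr_Z^*`, `∪` and then `pr_{Y*}` preserve rational classes).
[cite: VoisinHodgeI2002, §7.1.1, §11.1.2] [cite: VoisinHodgeII2003, §10.3.1 proof of Prop. 10.26] -/
theorem isRationalClass_corrAction_of_hasRationalFundamentalClasses {μ : OrientationFamily} (hμ : μ.HasRationalFundamentalClasses) (hY : IsSmoothProjective m Y) (hZ : IsSmoothProjective n Z)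
    {c i a : ℕ} (hab : a + 2 * c = i + 2 * n) {γ : complexBetti (Y ⊗ Z) (2 * c)} (hγ : IsRationalClass γ) {u : complexBetti Z a} (hu : IsRationalClass u) :
    IsRationalClass (corrAction μ hY hZ hab γ u) := by
  rw [corrAction_apply]
  exact isRationalClass_complexGysin_of_hasRationalFundamentalClasses hμ (hY.tensor_holds hZ) hY (fst Y Z) _ ((hu.map _).cup rfl hγ)

/-- **`γ_* u` is rational for `γ`, `u` rational** (complex orientations). [cite: VoisinHodgeI2002, §7.1.1, §11.1.2] [cite: VoisinHodgeII2003, §10.3.1 proof of Prop. 10.26] -/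
theorem isRationalClass_corrAction_complexOrientationFamily (hY : IsSmoothProjective m Y) (hZ : IsSmoothProjective n Z) {c i a : ℕ} (hab : a + 2 * c = i + 2 * n)
    {γ : complexBetti (Y ⊗ Z) (2 * c)} (hγ : IsRationalClass γ) {u : complexBetti Z a} (hu : IsRationalClass u) :
    IsRationalClass (corrAction complexOrientationFamily hY hZ hab γ u) := by
  rw [corrAction_apply]
  exact isRationalClass_complexGysin_complexOrientationFamily (hY.tensor_holds hZ) hY (fst Y Z) _ ((hu.map _).cup rfl hγ)

/-! ### §3 Hodge classes act on Hodge classes -/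

/-- **A Hodge class of `Y × Z` sends Hodge classes of `Z` to Hodge classes of `Y`**: for `γ ∈ Hdgᶜ(H^{2c}(Y × Z))` and `v ∈ Hdgᵖ(H^{2p}(Z))`, `(γ ⊗ 1)_*(v ⊗ 1) = w ⊗ 1` for a (unique) `w ∈ Hdg^{p'}(H^{2p'}(Y))`,
`p' + n = p + c` (complex orientations: rational of type `(p', p')`). [cite: VoisinHodgeI2002, §11.1.2 Prop. 11.20, §11.3.3 Lemma 11.41 and p. 286] [cite: VoisinHodgeII2003, §10.3.1 proof of Prop. 10.26] -/
theorem BettiUniverse.exists_mem_hodgeClasses_ofRatClass_eq_corrAction (hHD : exists_isReal_hodgeModel) (hY : IsSmoothProjective m Y) (hZ : IsSmoothProjective n Z) {c p p' : ℕ}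
    (hab : 2 * p + 2 * c = 2 * p' + 2 * n) {γ : bettiCohomology (Y ⊗ Z) (2 * c)} (hγ : γ ∈ (BettiUniverse.hodge hHD (hY.tensor_holds hZ) (2 * c)).hodgeClasses c)
    {v : bettiCohomology Z (2 * p)} (hv : v ∈ (BettiUniverse.hodge hHD hZ (2 * p)).hodgeClasses p) :
    ∃ w ∈ (BettiUniverse.hodge hHD hY (2 * p')).hodgeClasses p',
      ofRatClass (ComplexPoints Y) (2 * p') w = corrAction complexOrientationFamily hY hZ hab (ofRatClass (ComplexPoints (Y ⊗ Z)) (2 * c) γ) (ofRatClass (ComplexPoints Z) (2 * p) v) := by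
  have hγt := (BettiUniverse.mem_hodgeClasses_hodge_iff_isOfHodgeType hHD (hY.tensor_holds hZ) c γ).1 hγ
  have hvt := (BettiUniverse.mem_hodgeClasses_hodge_iff_isOfHodgeType hHD hZ p v).1 hv
  have hrat := isRationalClass_corrAction_complexOrientationFamily hY hZ hab (isRationalClass_ofRatClass γ) (isRationalClass_ofRatClass v)
  obtain ⟨w, hw⟩ := (isRationalClass_iff_mem_range_ofRatClass _).1 hrat
  refine ⟨w, (BettiUniverse.mem_hodgeClasses_hodge_iff_isOfHodgeType hHD hY p' w).2 ?_, hw⟩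
  rw [hw]
  exact isOfHodgeType_corrAction complexOrientationFamily hHD hY hZ hab hγt (by omega) (by omega) hvt

/-- **… and kills them below the relative dimension**: `(γ ⊗ 1)_*(v ⊗ 1) = 0` for `γ ∈ Hdgᶜ(H^{2c}(Y × Z))`, `v ∈ Hdgᵖ(H^{2p}(Z))` and `p + c < n` (no Hodge class of negative type).
[cite: VoisinHodgeI2002, §7.3.2 (7.11) and Lemma 7.28, §11.3.3 Lemma 11.41] -/
theorem BettiUniverse.corrAction_ofRatClass_eq_zero_of_mem_hodgeClasses_of_lt (hHD : exists_isReal_hodgeModel) (hY : IsSmoothProjective m Y) (hZ : IsSmoothProjective n Z) {c p i : ℕ}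
    (hab : 2 * p + 2 * c = i + 2 * n) (hlt : p + c < n) {γ : bettiCohomology (Y ⊗ Z) (2 * c)} (hγ : γ ∈ (BettiUniverse.hodge hHD (hY.tensor_holds hZ) (2 * c)).hodgeClasses c)
    {v : bettiCohomology Z (2 * p)} (hv : v ∈ (BettiUniverse.hodge hHD hZ (2 * p)).hodgeClasses p) :
    corrAction complexOrientationFamily hY hZ hab (ofRatClass (ComplexPoints (Y ⊗ Z)) (2 * c) γ) (ofRatClass (ComplexPoints Z) (2 * p) v) = 0 :=
  corrAction_eq_zero_of_isOfHodgeType_of_lt hHD hY hZ hab ((BettiUniverse.mem_hodgeClasses_hodge_iff_isOfHodgeType hHD (hY.tensor_holds hZ) c γ).1 hγ) (Or.inl hlt)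
    ((BettiUniverse.mem_hodgeClasses_hodge_iff_isOfHodgeType hHD hZ p v).1 hv)

end Literature.AlgebraicGeometry.HodgeTheory

end
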